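import Mathlib
import Literature.Analysis.FluidPDE.HardSphereCollisionRecord
import Literature.MathematicalPhysics.KineticTheory.HardSphereEuler
import Literature.MathematicalPhysics.KineticTheory.HardSphereEulerProofs
import Literature.MathematicalPhysics.KineticTheory.HardSphereEntranceProofs
import Summits.AtomisticToContinuum.HydrodynamicLimit.Theorems.OneFlightGossipEngineOneFlightLayeredChaosRegimes
import HarnessLib

/-!
# `OneFlightGossipEngine.OneFlightLayeredChaos` — the DISC-FORM regime frame and Lambert's cosine law
(crux stmt-AtomisticToContinuum-14535, line `Sketch`, lead cycle c3; disc-form reduction 1/4; registered stub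
`flux_eq_discLaw`)

This file is the line's FLUX → DISC frame: it declares, over the landed regime frame `Theorems.OLC` (`Regime`,
`rhoStar`, `RegimeFluxTail/Body`), the DISC FORM of the crux's dynamical stubs and proves the change of variables
that links it to the flux form.

* `OLC.discLaw g U` — the normalised uniform (area) law of the unit disc of the plane `g^⊥`, encoded through the
  Lebesgue measure of `ℝ³` of the solid unit cylinder over the disc (Cavalieri), so that no surface measure is needed.
* `OLC.RegimeDiscTail θ₀ σ bound X` / `OLC.RegimeDiscBody θ₀ X` — the flux-form frame `OLC.RegimeFluxTail/Body`
  VERBATIM (same lets `G ε w q P W gIn`, same events `E` of the coarse past), with the pair `(ĝ, ω)` (incoming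
  direction proxy, impact vector) replaced by `(ĝ, b)` and the flux law by `discLaw`, where
  `b = ε⁻¹ Π_{ĝ^⊥} sepVec(x_i(s⁺), x_j(s⁺))` is the TRANSVERSE OFFSET of the pair at the later flight start
  `s⁺ = max(s_i, s_j)` (positions of the flow at that time — exact, not in `𝒢`).
* `OLC.NoWrap θ₀ c` — inside the kinetic window no particle travels `c`: `P{∃ k, c ≤ ∫⁻_{(0,w]} ‖v_k‖} ≤ δ` for
  `N ≥ N₀(σ, τ, δ)`; `NoWrap θ₀ 4⁻¹` is the universal closure of the landed `Theorems.stub_noWrap`, the disc → flux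
  transfer (`…DiscTransfer.lean`) consumes the threshold `c = 8⁻¹`.
* Change of variables (`flux_eq_discLaw`, registered): for a unit vector `g` and measurable `U ⊆ ℝ³`,
  `Flux_g(U) = discLaw g {b | b − √(1 − ‖b‖²) g ∈ U}` — Lambert's cosine law `lintegral_sphere_innerPos_mul` of the
  tree (`lintegral_indicator_mul_negInnerPos_eq`, cylindrical coordinates `exists_axisDecomposition` adapted to `−g`)
  and Cavalieri for the solid cylinder in the same coordinates (`volume_discCylinder_eq`).

The open short-gap / long-gap stubs of the line become `RegimeDiscBody θ₀ <regime>` (event-level disc-uniformity of the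
flight-start transverse offset given the coarse past), consumed through `regimeFluxBody_of_regimeDiscBody` + `NoWrap θ₀ 8⁻¹`.
-/

open scoped BigOperators ENNReal
open MeasureTheory Set
open Literature.Analysis.FluidPDE Literature.MathematicalPhysics.KineticTheory

namespace Summit.AtomisticToContinuum.HydrodynamicLimit.Theorems.OLC

noncomputable section

/-! ## The disc-form regime frame (definitions) -/

/-- The normalised UNIFORM LAW OF THE UNIT DISC of the plane `g^⊥` (`g` a unit vector), evaluated on the transverse
parts `x − ⟪x, g⟫g ∈ U`: encoded as the ratio of Lebesgue volumes of the solid unit cylinders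
`{0 < ⟪x, g⟫ ≤ 1, ‖x − ⟪x,g⟫g‖ < 1, x − ⟪x,g⟫g ∈ U}` and `{0 < ⟪x, g⟫ ≤ 1, ‖x − ⟪x,g⟫g‖ < 1}` (Cavalieri:
`= area(U ∩ disc)/π`). [folklore] -/
def discLaw (g : V3) (U : Set V3) : ℝ :=
  ((volume {x : V3 | inner ℝ x g ∈ Set.Ioc (0 : ℝ) 1 ∧ ‖x - inner ℝ x g • g‖ < 1 ∧ x - inner ℝ x g • g ∈ U}) /
    (volume {x : V3 | inner ℝ x g ∈ Set.Ioc (0 : ℝ) 1 ∧ ‖x - inner ℝ x g • g‖ < 1})).toReal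

/-- The DISC-FORM tail of the crux on the regime `X` (activity `1`, temperature `θ₀`, mesh `ρ⋆(σ)`): the flux-form
tail `OLC.RegimeFluxTail` with the impact vector replaced by the TRANSVERSE OFFSET AT THE LATER FLIGHT START
`b(z) = ε⁻¹ (q − ⟪q, ĝ⟫ ĝ)`, `q = sepVec (x_i(s⁺)) (x_j(s⁺))`, `s⁺ = max(s_i, s_j)` (flight starts, from time `0`, of
`i` and of its `n`-th partner `j` before the `n`-th collision time of `i`; positions of the flow at time `s⁺`), and the
flux law replaced by the uniform law of the unit disc of `ĝ^⊥`:
`∀ τ > 0 ∀ n ∃ N₀ ∀ N ≥ N₀ ∀ Φ i, ∀ S ⊆ ℝ³ × ℝ³ measurable, ∀ E ∈ 𝒢,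
|P(W ∩ {(ĝ, b) ∈ S} ∩ (X ∩ E)) − ∫_{W ∩ (X ∩ E)} discLaw ĝ(z) S_{ĝ(z)} dP| ≤ bound`. [folklore] -/
def RegimeDiscTail (θ₀ σ bound : ℝ) (X : Regime) : Prop :=
  ∀ τ : ℝ, 0 < τ → ∀ n : ℕ, ∃ N₀ : ℕ, ∀ N : ℕ, N₀ ≤ N →
    ∀ Φ : HardSphereFlow (Torus.geometry (Fin 3)) (hsDiameter σ N) (N + 1),
    ∀ (i : Fin (N + 1)) (S : Set (V3 × V3)), MeasurableSet S →
    let G : Geometry (Fin 3) T3 := Torus.geometry (Fin 3)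
    let ε : ℝ := hsDiameter σ N
    let w : ℝ := τ * ((N + 1 : ℕ) : ℝ) ^ (-(1 / 3 : ℝ))
    let q : T3 → (Fin 3 → ℤ) := Torus.coarseCell (rhoStar σ * ((N + 1 : ℕ) : ℝ) ^ (-(1 / 3 : ℝ)))
    let P : Measure (Config (N + 1) (Fin 3) T3) := localGibbsLaw σ (fun _ => 1) (fun _ => 0) (fun _ => θ₀) N Φ
    let W : Set (Config (N + 1) (Fin 3) T3) :=
      {z | n + 1 ≤ Set.ncard (collisionTimesOf G ε (fun t => Φ.flow t z) i ∩ Set.Ioc 0 w)}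
    let gIn : Config (N + 1) (Fin 3) T3 → V3 := fun z =>
      ‖((Φ.coarsePastOf q i n z).1 i).2 - ((Φ.coarsePastOf q i n z).2 (Φ.nthPartnerOf i n z)).2‖⁻¹ •
        (((Φ.coarsePastOf q i n z).1 i).2 - ((Φ.coarsePastOf q i n z).2 (Φ.nthPartnerOf i n z)).2)
    let sPlus : Config (N + 1) (Fin 3) T3 → ℝ := fun z =>
      max (flightStart G ε (fun t => Φ.flow t z) 0 i (Φ.nthCollisionTimeOf i n z))
        (flightStart G ε (fun t => Φ.flow t z) 0 (Φ.nthPartnerOf i n z) (Φ.nthCollisionTimeOf i n z))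
    let bOff : Config (N + 1) (Fin 3) T3 → V3 := fun z =>
      ε⁻¹ • (G.sepVec (Φ.flow (sPlus z) z i).1 (Φ.flow (sPlus z) z (Φ.nthPartnerOf i n z)).1 -
        inner ℝ (G.sepVec (Φ.flow (sPlus z) z i).1 (Φ.flow (sPlus z) z (Φ.nthPartnerOf i n z)).1) (gIn z) •
          gIn z)
    ∀ E : Set (Config (N + 1) (Fin 3) T3),
      MeasurableSet[MeasurableSpace.comap (fun z => (Φ.coarsePastOf q i n z, Φ.nthPartnerOf i n z))
        inferInstance] E →
      |(P (W ∩ {z | (gIn z, bOff z) ∈ S} ∩ (X σ n N Φ i ∩ E))).toReal -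
          ∫ z in W ∩ (X σ n N Φ i ∩ E), discLaw (gIn z) {b | (gIn z, b) ∈ S} ∂P| ≤ bound

/-- The DISC-FORM body of the crux on the regime `X`: `∃ C p σ₀ > 0, ∀ σ ∈ (0, σ₀), RegimeDiscTail θ₀ σ (C σ^p) X` —
"given the coarse past, on `X`, the transverse offset of the colliding pair at the later flight start is uniform on the
`ε`-disc of `ĝ^⊥` up to `C σ^p` in `L¹(𝒢)`, uniformly in `n, τ`, for `N ≥ N₀(σ, τ, n)`". [folklore] -/
def RegimeDiscBody (θ₀ : ℝ) (X : Regime) : Prop :=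
  ∃ C : ℝ, 0 < C ∧ ∃ p : ℝ, 0 < p ∧ ∃ σ₀ : ℝ, 0 < σ₀ ∧ ∀ σ : ℝ, 0 < σ → σ < σ₀ →
    RegimeDiscTail θ₀ σ (C * σ ^ p) X

/-- **No wrap-around at threshold `c`**: under the global Gibbs law at activity `1` and temperature `θ₀`, the
probability that some particle travels at least `c` during the kinetic window `(0, τ (N+1)^{-1/3}]` is at most `δ`
for `N ≥ N₀(σ, τ, δ)` (`0 < σ ≤ 1/2`).  `NoWrap θ₀ 4⁻¹` is the universal closure of the landed `Theorems.stub_noWrap`;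
the disc → flux transfer `regimeFluxBody_of_regimeDiscBody` uses `c = 8⁻¹`. [folklore] -/
def NoWrap (θ₀ c : ℝ) : Prop :=
  ∀ σ : ℝ, 0 < σ → σ ≤ 2⁻¹ → ∀ τ : ℝ, 0 < τ → ∀ δ : ℝ, 0 < δ →
    ∃ N₀ : ℕ, ∀ N : ℕ, N₀ ≤ N → ∀ Φ : HardSphereFlow (Torus.geometry (Fin 3)) (hsDiameter σ N) (N + 1),
      localGibbsLaw σ (fun _ => 1) (fun _ => 0) (fun _ => θ₀) N Φ
          {z | ∃ k : Fin (N + 1), ENNReal.ofReal c ≤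
            ∫⁻ t in Set.Ioc 0 (τ * ((N + 1 : ℕ) : ℝ) ^ (-(1 / 3 : ℝ))), ENNReal.ofReal ‖(Φ.flow t z k).2‖} ≤
        ENNReal.ofReal δ

/-! ## Change of variables: the flux law of the hemisphere is the uniform law of the disc -/

/-- The pull-back `b ↦ b − √(1 − ‖b‖²) g` of the disc onto the incoming hemisphere is measurable. [folklore] -/
theorem measurable_discToHemisphere (g : V3) : Measurable fun b : V3 => b - Real.sqrt (1 - ‖b‖ ^ 2) • g := by
  fun_prop

/-- The solid cylinder sets of `discLaw` are measurable. [folklore] -/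
theorem measurableSet_discCylinder (g : V3) {V : Set V3} (hV : MeasurableSet V) :
    MeasurableSet {x : V3 | inner ℝ x g ∈ Set.Ioc (0 : ℝ) 1 ∧ ‖x - inner ℝ x g • g‖ < 1 ∧ x - inner ℝ x g • g ∈ V} := by
  have hin : Measurable fun x : V3 => inner ℝ x g := by fun_prop
  have hproj : Measurable fun x : V3 => x - inner ℝ x g • g := by fun_prop
  have h1 : MeasurableSet {x : V3 | inner ℝ x g ∈ Set.Ioc (0 : ℝ) 1} := hin measurableSet_Ioc
  have h2 : MeasurableSet {x : V3 | ‖x - inner ℝ x g • g‖ < 1} := measurableSet_lt hproj.norm measurable_const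
  have h3 : MeasurableSet {x : V3 | x - inner ℝ x g • g ∈ V} := hproj hV
  simp only [Set.setOf_and]
  exact h1.inter (h2.inter h3)

/-- **Lambert's cosine law for the flux numerator.** In cylindrical coordinates `ι : ℝ² → (-g)^⊥` adapted to the
unit vector `-g`, `∫_{S²} 1_V(ω) (−⟪ω, g⟫)₊ dσ(ω) = vol{u ∈ B₁ ⊂ ℝ² | ι u − √(1 − ‖u‖²) g ∈ V}`. [folklore] -/
theorem lintegral_indicator_mul_negInnerPos_eq (g : V3) (hg : ‖g‖ = 1)
    (ι : EuclideanSpace ℝ (Fin 2) →ₗᵢ[ℝ] V3) (hι : ∀ u, inner ℝ (-g) (ι u) = 0)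
    (hmp : MeasurePreserving (fun p : ℝ × EuclideanSpace ℝ (Fin 2) => p.1 • (-g) + ι p.2)
      (volume.prod volume) volume)
    {V : Set V3} (hV : MeasurableSet V) :
    ∫⁻ ω, V.indicator (fun _ => (1 : ℝ≥0∞)) (ω : V3) * ENNReal.ofReal (max (-inner ℝ (ω : V3) g) 0)
        ∂(sphereMeasure (E := V3)) =
      volume ({u : EuclideanSpace ℝ (Fin 2) | ι u ∈ {b : V3 | b - Real.sqrt (1 - ‖b‖ ^ 2) • g ∈ V}} ∩
        Metric.ball 0 1) := by
  have he : ‖-g‖ = 1 := by rw [norm_neg, hg]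
  have hn : Module.finrank ℝ V3 = 2 + 1 := by rw [finrank_euclideanSpace_fin]
  have hV' : MeasurableSet {b : V3 | b - Real.sqrt (1 - ‖b‖ ^ 2) • g ∈ V} := measurable_discToHemisphere g hV
  have hpt : ∀ ω : Metric.sphere (0 : V3) 1,
      V.indicator (fun _ => (1 : ℝ≥0∞)) (ω : V3) * ENNReal.ofReal (max (-inner ℝ (ω : V3) g) 0) =
        ENNReal.ofReal (max (inner ℝ (-g) (ω : V3)) 0) *
          {b : V3 | b - Real.sqrt (1 - ‖b‖ ^ 2) • g ∈ V}.indicator (fun _ => (1 : ℝ≥0∞))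
            ((ω : V3) - inner ℝ (-g) (ω : V3) • (-g)) := by
    intro ω
    have hω : ‖(ω : V3)‖ = 1 := mem_sphere_zero_iff_norm.1 ω.2
    have hc : inner ℝ (-g) (ω : V3) = -inner ℝ (ω : V3) g := by rw [inner_neg_left, real_inner_comm]
    rw [← hc]
    by_cases hpos : 0 < inner ℝ (-g) (ω : V3)
    · -- on the incoming hemisphere the projection inverts: `ω = p + √(1 - ‖p‖²) (-g)`, `p = ω - ⟪-g, ω⟫ (-g)`
      have hsq : ‖(ω : V3) - inner ℝ (-g) (ω : V3) • (-g)‖ ^ 2 = 1 - inner ℝ (-g) (ω : V3) ^ 2 := by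
        rw [norm_sub_sq_real, hω, real_inner_smul_right, real_inner_comm, norm_smul, he, mul_one,
          Real.norm_eq_abs, sq_abs]
        ring
      have hback : ((ω : V3) - inner ℝ (-g) (ω : V3) • (-g)) -
          Real.sqrt (1 - ‖(ω : V3) - inner ℝ (-g) (ω : V3) • (-g)‖ ^ 2) • g = (ω : V3) := by
        rw [hsq, sub_sub_cancel, Real.sqrt_sq hpos.le, smul_neg, sub_neg_eq_add, add_sub_cancel_right]
      have hmem : (ω : V3) ∈ V ↔
          ((ω : V3) - inner ℝ (-g) (ω : V3) • (-g)) ∈ {b : V3 | b - Real.sqrt (1 - ‖b‖ ^ 2) • g ∈ V} := by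
        rw [mem_setOf_eq, hback]
      by_cases hωV : (ω : V3) ∈ V
      · rw [indicator_of_mem hωV, indicator_of_mem (hmem.1 hωV), one_mul, mul_one]
      · rw [indicator_of_notMem hωV, indicator_of_notMem (fun h => hωV (hmem.2 h)), zero_mul, mul_zero]
    · rw [max_eq_right (not_lt.1 hpos), ENNReal.ofReal_zero, mul_zero, zero_mul]
  have hS : MeasurableSet ({u : EuclideanSpace ℝ (Fin 2) | ι u ∈ {b : V3 | b - Real.sqrt (1 - ‖b‖ ^ 2) • g ∈ V}} ∩
      Metric.ball 0 1) := (hV'.preimage ι.continuous.measurable).inter Metric.isOpen_ball.measurableSet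
  rw [lintegral_congr fun ω => hpt ω, lintegral_sphere_innerPos_mul hn he ι hι hmp (measurable_const.indicator hV'),
    ← lintegral_indicator_one hS, ← lintegral_indicator Metric.isOpen_ball.measurableSet]
  congr 1
  funext u
  simp only [indicator, mem_inter_iff, mem_setOf_eq, Pi.one_apply]
  by_cases hu : u ∈ Metric.ball (0 : EuclideanSpace ℝ (Fin 2)) 1
  · by_cases hu' : ι u - Real.sqrt (1 - ‖ι u‖ ^ 2) • g ∈ V
    · rw [if_pos hu, if_pos hu', if_pos ⟨hu', hu⟩]
    · rw [if_pos hu, if_neg hu', if_neg (fun h => hu' h.1)]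
  · rw [if_neg hu, if_neg (fun h => hu h.2)]

/-- **Cavalieri for the solid cylinder.** In the same adapted coordinates,
`vol{x | 0 < ⟪x, g⟫ ≤ 1, ‖x − ⟪x,g⟫g‖ < 1, x − ⟪x,g⟫g ∈ V} = vol{u ∈ B₁ ⊂ ℝ² | ι u ∈ V}`. [folklore] -/
theorem volume_discCylinder_eq (g : V3) (hg : ‖g‖ = 1)
    (ι : EuclideanSpace ℝ (Fin 2) →ₗᵢ[ℝ] V3) (hι : ∀ u, inner ℝ (-g) (ι u) = 0)
    (hmp : MeasurePreserving (fun p : ℝ × EuclideanSpace ℝ (Fin 2) => p.1 • (-g) + ι p.2)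
      (volume.prod volume) volume)
    {V : Set V3} (hV : MeasurableSet V) :
    volume {x : V3 | inner ℝ x g ∈ Set.Ioc (0 : ℝ) 1 ∧ ‖x - inner ℝ x g • g‖ < 1 ∧ x - inner ℝ x g • g ∈ V} =
      volume ({u : EuclideanSpace ℝ (Fin 2) | ι u ∈ V} ∩ Metric.ball 0 1) := by
  have heg : inner ℝ (-g) g = -1 := by
    rw [inner_neg_left, real_inner_self_eq_norm_sq, hg]; norm_num
  have hιg : ∀ u, inner ℝ (ι u) g = 0 := fun u => by
    have h := hι u
    rw [inner_neg_left, neg_eq_zero, real_inner_comm] at h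
    exact h
  rw [← hmp.measure_preimage (measurableSet_discCylinder g hV).nullMeasurableSet]
  have hset : (fun p : ℝ × EuclideanSpace ℝ (Fin 2) => p.1 • (-g) + ι p.2) ⁻¹'
      {x : V3 | inner ℝ x g ∈ Set.Ioc (0 : ℝ) 1 ∧ ‖x - inner ℝ x g • g‖ < 1 ∧ x - inner ℝ x g • g ∈ V} =
      Set.Ico (-1 : ℝ) 0 ×ˢ ({u : EuclideanSpace ℝ (Fin 2) | ι u ∈ V} ∩ Metric.ball 0 1) := by
    ext ⟨a, u⟩
    have hx : inner ℝ (a • (-g) + ι u) g = -a := by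
      rw [inner_add_left, real_inner_smul_left, heg, hιg]; ring
    have hp : a • (-g) + ι u - (-a) • g = ι u := by
      rw [smul_neg, neg_smul, sub_neg_eq_add]; abel
    simp only [mem_preimage, mem_setOf_eq, hx, hp, LinearIsometry.norm_map, mem_prod, mem_Ico, mem_Ioc,
      mem_inter_iff, Metric.mem_ball, dist_zero_right]
    constructor
    · rintro ⟨⟨h1, h2⟩, h3, h4⟩; exact ⟨⟨by linarith, by linarith⟩, h4, h3⟩
    · rintro ⟨⟨h1, h2⟩, h3, h4⟩; exact ⟨⟨by linarith, by linarith⟩, h4, h3⟩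
  rw [hset, Measure.prod_prod, Real.volume_Ico]
  norm_num

/-- **Flux law = uniform disc law** (registered stub `flux_eq_discLaw` of crux stmt-AtomisticToContinuum-14535, line
`Sketch`; Lambert's cosine law `lintegral_sphere_innerPos_mul` + Cavalieri for the solid cylinder): for a unit vector `g`
and measurable `U ⊆ ℝ³`, `Flux_g(U) = discLaw g {b | b − √(1 − ‖b‖²) g ∈ U}`, `Flux_g` being the normalised flux law
of the flux-form frame `OLC.RegimeFluxTail` and `discLaw` the disc law of the disc-form frame `OLC.RegimeDiscTail`. [folklore] -/
theorem flux_eq_discLaw : ∀ (g : Literature.MathematicalPhysics.KineticTheory.V3), ‖g‖ = 1 → ∀ {U : Set Literature.MathematicalPhysics.KineticTheory.V3}, MeasurableSet U → ((∫⁻ ω, U.indicator (fun _ => (1 : ENNReal)) (ω : Literature.MathematicalPhysics.KineticTheory.V3) * ENNReal.ofReal (max (-inner ℝ (ω : Literature.MathematicalPhysics.KineticTheory.V3) g) 0) ∂(Literature.MathematicalPhysics.KineticTheory.sphereMeasure (E := Literature.MathematicalPhysics.KineticTheory.V3))) / (∫⁻ ω, ENNReal.ofReal (max (-inner ℝ (ω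 : Literature.MathematicalPhysics.KineticTheory.V3) g) 0) ∂(Literature.MathematicalPhysics.KineticTheory.sphereMeasure (E := Literature.MathematicalPhysics.KineticTheory.V3)))).toReal = Summit.AtomisticToContinuum.HydrodynamicLimit.Theorems.OLC.discLaw g {b : Literature.MathematicalPhysics.KineticTheory.V3 | b - Real.sqrt (1 - ‖b‖ ^ 2) • g ∈ U} := by
  intro g hg U hU
  have he : ‖-g‖ = 1 := by rw [norm_neg, hg]
  have hn : Module.finrank ℝ V3 = 2 + 1 := by rw [finrank_euclideanSpace_fin]
  obtain ⟨ι, hι, hmp⟩ := exists_axisDecomposition hn (-g) he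
  have hU' : MeasurableSet {b : V3 | b - Real.sqrt (1 - ‖b‖ ^ 2) • g ∈ U} := measurable_discToHemisphere g hU
  have hden : ∫⁻ ω, ENNReal.ofReal (max (-inner ℝ (ω : V3) g) 0) ∂(sphereMeasure (E := V3)) =
      volume (Metric.ball (0 : EuclideanSpace ℝ (Fin 2)) 1) := by
    have h := lintegral_indicator_mul_negInnerPos_eq g hg ι hι hmp MeasurableSet.univ
    simpa using h
  have hcyl0 : volume {x : V3 | inner ℝ x g ∈ Set.Ioc (0 : ℝ) 1 ∧ ‖x - inner ℝ x g • g‖ < 1} =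
      volume (Metric.ball (0 : EuclideanSpace ℝ (Fin 2)) 1) := by
    have h := volume_discCylinder_eq g hg ι hι hmp MeasurableSet.univ
    simpa using h
  rw [discLaw, volume_discCylinder_eq g hg ι hι hmp hU', hcyl0, lintegral_indicator_mul_negInnerPos_eq g hg ι hι hmp hU,
    hden]

end

end Summit.AtomisticToContinuum.HydrodynamicLimit.Theorems.OLC
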